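import Summits.AtomisticToContinuum.Crystallization.Theorems.FrustratedLawDichotomyTransportPriceEquilibrium
import Summits.AtomisticToContinuum.Crystallization.Theorems.FrustratedLawDichotomyThinning

/-!
# FrustratedLawDichotomy · crux `AperiodicFrustratedLawGap` (stmt-AtomisticToContinuum-27623) — THE MARKED PRICE: WEAK PRICE EVERYWHERE, STRICT PRICE AT DENSE DEFECTS
# (decomp-a2c, prover hand 2, structural share, generation 3)

The weakest child of the transport line.  A strict price at EVERY atom is more than the crux needs: by the Mecke identity once more,

* `measure_pos_of_dense_marks` — **relatively dense marks have positive Palm probability**: if `M` is a measurable set of rooted configurations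
  («the root is marked») and almost surely SOME atom within distance `L` of the root is marked (`θ_q μ ∈ M`, `‖q‖ ≤ L`), then `P(M) > 0`
  (send unit mass to every marked atom within `L`: out-flow `≥ 1`, in-flow `≤ #B̄_L · 1_M`);
* `lt_integral_of_ae_le_of_not_ae_le` — an integrable `g ≥ c` a.s. which is not a.s. `≤ c` has `∫ g > c`;
* `lt_integral_rootEnergy_of_markedTransport` — hence a covariant transport whose redistributed root energy is `≥ c` almost surely and `> c`
  whenever the root is marked, with marks almost surely `L`-dense, gives `c < E_P[rootEnergy]`;

and the LAW-FREE MARKED-PRICE DOORS by name (`aperiodicFrustratedLawGap_of_markedTransportPrice`, registered-stub and `PeriodicChargeSplit`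
versions): the crux follows from ONE jointly measurable covariant transport `F` (bounded out-flow on textured `7/10`-hard-core configurations),
ONE measurable mark `M` and ONE radius `L` such that every admissible rooted configuration (δ- and 7/10-hard-core, texture-charged, Nash, force
balance, Laplacian stability, near neighbour, infinite, non-periodic) has redistributed root energy `≥ e⋆`, STRICTLY `> e⋆` when the root is
marked, and a marked atom within `L` of the root.  Reading: «frustrated matter never goes below `e⋆` after redistribution, the DEFECTS (coarse
T-sites, holes, non-T sites — whatever the mark selects from the texture clauses, which make them relatively dense) pay strictly» — the first
door of this crux in which the texture hypothesis (d) has a job to do (it supplies the density of the marks).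

All `[folklore]`.
-/

noncomputable section

namespace Summit.AtomisticToContinuum.Crystallization.Theorems.FrustratedLawDichotomyTransportPriceMarked

open MeasureTheory Metric Set Filter
open scoped ENNReal Topology BigOperators
open Literature.MathematicalPhysics.StatisticalMechanics Literature.Probability.Process
open Summit.AtomisticToContinuum.Crystallization.Theorems.ChargedEnergyGapNegative (E3 eStar)
open Summit.AtomisticToContinuum.Crystallization.Theorems.FrustratedLawDichotomyFiniteClusterGap
  (ae_mem_of_sep exists_kernel_eq_count_restrict measurable_kernel_map_sub)
open Summit.AtomisticToContinuum.Crystallization.Theorems.FrustratedLawDichotomyTransportPrice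
  (integral_redistributed_eq lintegral_outflow_ne_top_of_bound)
open Summit.AtomisticToContinuum.Crystallization.Theorems.FrustratedLawDichotomyThinning (map_sub_map_sub_neg)
open Summit.AtomisticToContinuum.Crystallization.Theorems.FrustratedLawDichotomyHardCoreUpgrade (ae_isRootedHardCore_upgrade)
open Summit.AtomisticToContinuum.Crystallization.Theorems.FrustratedLawDichotomyAperiodicGapFiniteCut (ae_infinite_of_minimising_of_decl)
open Summit.AtomisticToContinuum.Crystallization.Theorems.FrustratedLawDichotomyErgodicReduction
  (aperiodicFrustratedLawGap_iff_ergodicCase periodicChargeSplit_aperiodicFrustratedLawGap_iff_ergodicCase)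
open Summit.AtomisticToContinuum.Crystallization.Theorems.FrustratedLawDichotomyNashForceBalance (ae_forceBalance_of_nash)
open Summit.AtomisticToContinuum.Crystallization.Theorems.FrustratedLawDichotomyNashLocalStability
  (ae_laplacian_nonneg_of_nash ae_exists_near_of_nash)
open Literature.Probability.Process.LocalConfig (exists_forall_encard_inter_le finite_inter_of_separated)

section LawLevel

variable {δ : ℝ} {P : Measure (Measure E3)}

/-- On a probability space, an integrable `g` with `c ≤ g` almost surely and NOT `g ≤ c` almost surely has `c < ∫ g`. [folklore] -/
theorem lt_integral_of_ae_le_of_not_ae_le [IsProbabilityMeasure P] {g : Measure E3 → ℝ} (hI : Integrable g P) {c : ℝ}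
    (hle : ∀ᵐ μ ∂P, c ≤ g μ) (hne : ¬ ∀ᵐ μ ∂P, g μ ≤ c) : c < ∫ μ, g μ ∂P := by
  have hIc : Integrable (fun μ => g μ - c) P := hI.sub (integrable_const c)
  have hnn : 0 ≤ᵐ[P] fun μ => g μ - c := by
    filter_upwards [hle] with μ hμ
    exact sub_nonneg.mpr hμ
  by_contra hlt
  have hle' : ∫ μ, g μ ∂P ≤ c := not_lt.mp hlt
  have hzero : ∫ μ, g μ - c ∂P = 0 := by
    refine le_antisymm ?_ (integral_nonneg_of_ae hnn)
    rw [integral_sub hI (integrable_const c), integral_const, smul_eq_mul, probReal_univ, one_mul]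
    exact sub_nonpos.mpr hle'
  have hae : (fun μ => g μ - c) =ᵐ[P] 0 := (integral_eq_zero_iff_of_nonneg_ae hnn hIc).mp hzero
  refine hne ?_
  filter_upwards [hae] with μ h0
  have h0' : g μ - c = 0 := h0
  linarith

/-- **Relatively dense marks have positive Palm probability.**  Let `P` be a point-stationary probability law almost surely carried by rooted
`δ`-hard-core configurations, `M` a measurable set of rooted configurations, and suppose that almost surely some atom `q` with `‖q‖ ≤ L` is
marked (`θ_q μ ∈ M`).  Then `P M ≠ 0` (mass transport: unit mass to every marked atom within `L`). [folklore] -/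
theorem measure_pos_of_dense_marks (hδ : 0 < δ) [IsProbabilityMeasure P] (hcore : ∀ᵐ μ ∂P, IsRootedHardCore δ μ)
    (hstat : IsPointStationaryLaw P) {M : Set (Measure E3)} (hM : MeasurableSet M) {L : ℝ}
    (hdense : ∀ᵐ μ ∂P, ∃ q : E3, μ {q} ≠ 0 ∧ ‖q‖ ≤ L ∧ μ.map (fun z : E3 => z - q) ∈ M) : P M ≠ 0 := by
  classical
  obtain ⟨κ, hκs, hκ⟩ := exists_kernel_eq_count_restrict hδ
  obtain ⟨C₀, hC₀⟩ := exists_forall_encard_inter_le (E := E3) hδ (isCompact_closedBall (0 : E3) L)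
  set F : Measure E3 → E3 → ℝ≥0∞ := fun ν y =>
    (closedBall (0 : E3) L).indicator (fun _ => (1 : ℝ≥0∞)) y * M.indicator (fun _ => (1 : ℝ≥0∞)) ((κ ν).map fun z : E3 => z - y)
    with hF
  have hFm : Measurable (Function.uncurry F) :=
    ((measurable_const.indicator measurableSet_closedBall).comp measurable_snd).mul
      ((measurable_const.indicator hM).comp (measurable_kernel_map_sub κ))
  have hMTP := hstat F hFm
  have hκ_of : ∀ ν : Measure E3, IsRootedHardCore δ ν → κ ν = ν := fun ν hν => by
    obtain ⟨S, -, hsep, rfl⟩ := hν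
    exact hκ S hsep
  -- out-flow ≥ 1 almost surely
  have hout : ∀ᵐ μ ∂P, 1 ≤ ∫⁻ y, F μ y ∂μ := by
    filter_upwards [hcore, hdense] with μ hμ hq
    obtain ⟨q, hq, hqL, hqM⟩ := hq
    obtain ⟨S, h0S, hsep, hμS⟩ := id hμ
    have hqS : q ∈ S := by
      rw [hμS] at hq; exact (count_restrict_singleton_ne_zero_iff S q).mp hq
    have hq1 : μ {q} = 1 := by
      rw [hμS, Measure.restrict_apply (measurableSet_singleton q),
        Set.inter_eq_left.mpr (Set.singleton_subset_iff.mpr hqS), Measure.count_singleton]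
    have hFq : F μ q = 1 := by
      simp only [hF, hκ_of μ hμ]
      rw [indicator_of_mem (by rwa [mem_closedBall, dist_zero_right]), indicator_of_mem hqM, one_mul]
    calc (1 : ℝ≥0∞) = ∫⁻ y, ({q} : Set E3).indicator (fun _ => (1 : ℝ≥0∞)) y ∂μ := by
          rw [lintegral_indicator_const (measurableSet_singleton q), hq1, one_mul]
      _ ≤ ∫⁻ y, F μ y ∂μ := lintegral_mono fun y => by
          by_cases hy : y = q
          · subst hy; rw [indicator_of_mem (mem_singleton _), hFq]
          · rw [indicator_of_notMem (show y ∉ ({q} : Set E3) from hy)]; exact zero_le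
  -- in-flow ≤ C₀ · 1_M almost surely
  have hin : ∀ᵐ μ ∂P, ∫⁻ y, F (μ.map fun z : E3 => z - y) (-y) ∂μ ≤ M.indicator (fun _ => (C₀ : ℝ≥0∞)) μ := by
    filter_upwards [hcore] with μ hμ
    obtain ⟨S, h0S, hsep, hμS⟩ := id hμ
    have hS : ∀ᵐ y ∂μ, y ∈ S := by
      rw [hμS]; exact ae_mem_of_sep hδ hsep
    have hcard : μ (closedBall (0 : E3) L) ≤ (C₀ : ℝ≥0∞) := by
      have hfin : (closedBall (0 : E3) L ∩ S).Finite := finite_of_encard_le_coe (hC₀ S hsep)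
      rw [hμS, Measure.restrict_apply measurableSet_closedBall, Measure.count_apply_finite _ hfin]
      have h := hC₀ S hsep
      rw [hfin.encard_eq_coe_toFinset_card, Nat.cast_le] at h
      exact_mod_cast h
    calc ∫⁻ y, F (μ.map fun z : E3 => z - y) (-y) ∂μ
        = ∫⁻ y, (closedBall (0 : E3) L).indicator (fun _ => (1 : ℝ≥0∞)) y * M.indicator (fun _ => (1 : ℝ≥0∞)) μ ∂μ := by
          refine lintegral_congr_ae ?_
          filter_upwards [hS] with y hy
          have hy' : μ {y} ≠ 0 := by rw [hμS]; exact (count_restrict_singleton_ne_zero_iff S y).mpr hy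
          have hθ : IsRootedHardCore δ (μ.map fun z : E3 => z - y) := hμ.map_sub hy'
          simp only [hF, hκ_of _ hθ, map_sub_map_sub_neg]
          congr 1
          by_cases hyL : y ∈ closedBall (0 : E3) L
          · have : -y ∈ closedBall (0 : E3) L := by
              rw [mem_closedBall, dist_zero_right] at hyL ⊢; rwa [norm_neg]
            rw [indicator_of_mem this, indicator_of_mem hyL]
          · have : -y ∉ closedBall (0 : E3) L := by
              rw [mem_closedBall, dist_zero_right] at hyL ⊢; rwa [norm_neg]
            rw [indicator_of_notMem this, indicator_of_notMem hyL]
      _ = μ (closedBall (0 : E3) L) * M.indicator (fun _ => (1 : ℝ≥0∞)) μ := by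
          rw [lintegral_mul_const _ (measurable_const.indicator measurableSet_closedBall),
            lintegral_indicator_const measurableSet_closedBall, one_mul]
      _ ≤ M.indicator (fun _ => (C₀ : ℝ≥0∞)) μ := by
          by_cases hμM : μ ∈ M
          · rw [indicator_of_mem hμM, indicator_of_mem hμM, mul_one]; exact hcard
          · rw [indicator_of_notMem hμM, indicator_of_notMem hμM, mul_zero]
  -- Mecke: 1 ≤ E[out] = E[in] ≤ C₀ · P(M)
  have h1 : (1 : ℝ≥0∞) ≤ ∫⁻ μ, ∫⁻ y, F μ y ∂μ ∂P := by
    calc (1 : ℝ≥0∞) = ∫⁻ _μ, 1 ∂P := by rw [lintegral_const, measure_univ, mul_one]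
      _ ≤ _ := lintegral_mono_ae hout
  have h2 : ∫⁻ μ, ∫⁻ y, F (μ.map fun z : E3 => z - y) (-y) ∂μ ∂P ≤ C₀ * P M := by
    calc ∫⁻ μ, ∫⁻ y, F (μ.map fun z : E3 => z - y) (-y) ∂μ ∂P ≤ ∫⁻ μ, M.indicator (fun _ => (C₀ : ℝ≥0∞)) μ ∂P := lintegral_mono_ae hin
      _ = C₀ * P M := lintegral_indicator_const hM _
  intro hPM
  rw [hPM, mul_zero] at h2
  have h := h1.trans (hMTP.le.trans h2)
  exact absurd h (by simp)

/-- **Weak price everywhere, strict price at dense marks.**  Let `P` be a point-stationary probability law almost surely carried by rooted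
`δ`-hard-core configurations, `F` a jointly measurable covariant transport of finite mean out-flow, `M` a measurable mark with almost surely a
marked atom within `L` of the root.  If almost surely the redistributed root energy is `≥ c`, and `> c` whenever the root is marked, then
`c < E_P[rootEnergy]`. [folklore] -/
theorem lt_integral_rootEnergy_of_markedTransport (hδ : 0 < δ) [IsProbabilityMeasure P] (hcore : ∀ᵐ μ ∂P, IsRootedHardCore δ μ)
    (hstat : IsPointStationaryLaw P) {F : Measure E3 → E3 → ℝ≥0∞} (hF : Measurable (Function.uncurry F))
    (hout : ∫⁻ μ, ∫⁻ y, F μ y ∂μ ∂P ≠ ∞) {M : Set (Measure E3)} (hM : MeasurableSet M) {L : ℝ}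
    (hdense : ∀ᵐ μ ∂P, ∃ q : E3, μ {q} ≠ 0 ∧ ‖q‖ ≤ L ∧ μ.map (fun z : E3 => z - q) ∈ M) {c : ℝ}
    (hle : ∀ᵐ μ ∂P, c ≤ rootEnergy lennardJones μ + (∫⁻ y, F (μ.map fun z => z - y) (-y) ∂μ).toReal - (∫⁻ y, F μ y ∂μ).toReal)
    (hstrict : ∀ᵐ μ ∂P, μ ∈ M →
      c < rootEnergy lennardJones μ + (∫⁻ y, F (μ.map fun z => z - y) (-y) ∂μ).toReal - (∫⁻ y, F μ y ∂μ).toReal) :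
    c < ∫ μ, rootEnergy lennardJones μ ∂P := by
  obtain ⟨hI, heq⟩ := integral_redistributed_eq hδ hcore hstat hF hout
  rw [← heq]
  refine lt_integral_of_ae_le_of_not_ae_le hI hle fun hall => ?_
  have hnot : ∀ᵐ μ ∂P, μ ∉ M := by
    filter_upwards [hall, hstrict] with μ h₁ h₂ hμM
    exact absurd (h₂ hμM) (not_lt.mpr h₁)
  exact measure_pos_of_dense_marks hδ hcore hstat hM hdense (measure_eq_zero_iff_ae_notMem.mpr hnot)

end LawLevel

/-! ## The law-free marked-price doors -/

/-- **MARKED-PRICE DOOR (crux, by name).**  `AperiodicFrustratedLawGap` follows from: for every `δ > 0` and texture radii `R₇ R₈ R₉` there are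
ONE jointly measurable covariant transport `F` (out-flow uniformly bounded on textured `7/10`-hard-core rooted configurations), ONE measurable
mark `M` and ONE radius `L` such that every admissible rooted configuration (δ- and 7/10-hard-core, texture-charged, Nash, force-balanced,
Laplacian-stable, near-neighboured, infinite, non-periodic) has redistributed root energy `≥ e⋆`, strictly `> e⋆` if the root is marked, and
some marked atom `q` (`θ_q μ ∈ M`) with `‖q‖ ≤ L`. [folklore] -/
theorem aperiodicFrustratedLawGap_of_markedTransportPrice
    (h : ∀ δ : ℝ, 0 < δ → ∀ R₇ R₈ R₉ : ℝ, let Gy : ℝ → (N : ℕ) → (Fin N → EuclideanSpace ℝ (Fin 3)) → Fin N → Prop := fun η N y j => let d : ℝ := sInf ((fun z => dist z (y (j : Fin N))) '' (Set.range (y) \ {(y (j : Fin N))})); let T : Set (EuclideanSpace ℝ (Fin 3)) := {z : EuclideanSpace ℝ (Fin 3) | z ∈ Set.range (y) ∧ z ≠ (y (j : Fin N)) ∧ dist z (y (j : Fin N)) < 13 / 10 * d}; ∃ A : EuclideanSpace ℝ (Fin 3) →ₗᵢ[ℝ] EuclideanSpace ℝ (Fin 3), (∃ e : ↥T ≃ ↥Literature.Geometry.DiscreteGeometry.fccKissingPattern,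 ∀ t : ↥T, dist (d⁻¹ • ((t : EuclideanSpace ℝ (Fin 3)) - (y (j : Fin N)))) (A ((e t : ↥Literature.Geometry.DiscreteGeometry.fccKissingPattern) : EuclideanSpace ℝ (Fin 3))) ≤ η) ∨ (∃ e : ↥T ≃ ↥Literature.Geometry.DiscreteGeometry.hcpKissingPattern, ∀ t : ↥T, dist (d⁻¹ • ((t : EuclideanSpace ℝ (Fin 3)) - (y (j : Fin N)))) (A ((e t : ↥Literature.Geometry.DiscreteGeometry.hcpKissingPattern) : EuclideanSpace ℝ (Fin 3))) ≤ η); let TexBall : (N : ℕ) → (Fin N → EuclideanSpace ℝ (Fin 3)) → Fin N → ℝ → ℝ → ℝ → ℝ → Prop := fun N y i R R₇ R₈ R₉ => (∀ a b : Fin N, a ≠ b → (7 : ℝ) / 10 ≤ dist (y a) (y b)) ∧ (∀ j : Fin N, dist (y j) (y i) ≤ R → ¬ Gy (1 / 20) N (y) j) ∧ (∀ j : Fin N, dist (y j) (y i) ≤ R → ¬ ((∀ j' : Fin N, dist (y j') (y j) ≤ R₇ → ¬ Gy (1 / 20) N (y) j') ∧ (∀ z : EuclideanSpace ℝ (Fin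 3), dist z (y j) ≤ R₇ → ∃ k : Fin N, dist z (y k) ≤ 1) ∧ (∀ j' : Fin N, dist (y j') (y j) ≤ R₇ → (let d : ℝ := sInf ((fun z => dist z (y j')) '' (Set.range (y) \ {(y j')})); ∀ k : Fin N, y k ≠ y j' → dist (y k) (y j') < 27 / 20 * d → 5 ≤ Nat.card {m : Fin N // y m ≠ y j' ∧ dist (y m) (y j') < 27 / 20 * d ∧ y m ≠ y k ∧ dist (y m) (y k) < 27 / 20 * d})))) ∧ (∀ j : Fin N, dist (y j) (y i) ≤ R → ∃ k : Fin N, dist (y k) (y j) ≤ R₈ ∧ Gy (1 / 8) N (y) k) ∧ (∀ j : Fin N, dist (y j) (y i) ≤ R → ¬ ((∀ j' : Fin N, dist (y j') (y j) ≤ R₉ → ¬ Gy (1 / 20) N (y) j') ∧ (Nat.card {j' : Fin N // dist (y j') (y j) ≤ R₉ ∧ ¬ Gy (1 / 8) N (y) j'} : ℝ) ≤ 1 / 2 * (Nat.card {j' : Fin N // dist (y j') (y j) ≤ R₉} : ℝ) ∧ (∀ j' : Fin N, dist (y j') (y j) ≤ R₉ → ¬ Gy (1 / 8) N (y) j' →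 ¬ (let d : ℝ := sInf ((fun z => dist z (y j')) '' (Set.range (y) \ {(y j')})); ∀ k : Fin N, y k ≠ y j' → dist (y k) (y j') < 27 / 20 * d → 5 ≤ Nat.card {m : Fin N // y m ≠ y j' ∧ dist (y m) (y j') < 27 / 20 * d ∧ y m ≠ y k ∧ dist (y m) (y k) < 27 / 20 * d})))); let Appr : MeasureTheory.Measure (EuclideanSpace ℝ (Fin 3)) → ℝ → ℝ → ℝ → Prop := fun μ R₇ R₈ R₉ => ∀ q : EuclideanSpace ℝ (Fin 3), μ {q} ≠ 0 → ∀ R ε : ℝ, 0 < ε → ∃ (N : ℕ) (y : Fin N → EuclideanSpace ℝ (Fin 3)) (i : Fin N), TexBall N y i R R₇ R₈ R₉ ∧ (∀ p : EuclideanSpace ℝ (Fin 3), μ {p} ≠ 0 → dist p q ≤ R → ∃ k : Fin N, dist (y k - y i) (p - q) ≤ ε) ∧ (∀ k : Fin N, dist (y k) (y i) ≤ R → ∃ p : EuclideanSpace ℝ (Fin 3), μ {p} ≠ 0 ∧ dist (y k - y i) (p - q) ≤ ε); ∃ F : MeasureTheory.Measure (EuclideanSpace ℝ (Fin 3)) →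 EuclideanSpace ℝ (Fin 3) → ENNReal, Measurable (Function.uncurry F) ∧ (∃ C : ENNReal, C ≠ ⊤ ∧ ∀ μ : MeasureTheory.Measure (EuclideanSpace ℝ (Fin 3)), Literature.Probability.Process.IsRootedHardCore (7 / 10) μ → Appr μ R₇ R₈ R₉ → (∫⁻ y, F μ y ∂μ) ≤ C) ∧ ∃ M : Set (MeasureTheory.Measure (EuclideanSpace ℝ (Fin 3))), MeasurableSet M ∧ ∃ L : ℝ, (∀ μ : MeasureTheory.Measure (EuclideanSpace ℝ (Fin 3)), Literature.Probability.Process.IsRootedHardCore δ μ → Literature.Probability.Process.IsRootedHardCore (7 / 10) μ → Appr μ R₇ R₈ R₉ → (∀ p : EuclideanSpace ℝ (Fin 3), μ {p} ≠ 0 → ∀ y : EuclideanSpace ℝ (Fin 3), (∀ q : EuclideanSpace ℝ (Fin 3), μ {q} ≠ 0 → q ≠ p → y ≠ q) → ∑' q : {q : EuclideanSpace ℝ (Fin 3) // μ {q} ≠ 0 ∧ q ≠ p}, Literature.MathematicalPhysics.StatisticalMechanics.lennardJones (dist p (q : EuclideanSpace ℝ (Fin 3))) ≤ ∑' q : {q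 : EuclideanSpace ℝ (Fin 3) // μ {q} ≠ 0 ∧ q ≠ p}, Literature.MathematicalPhysics.StatisticalMechanics.lennardJones (dist y (q : EuclideanSpace ℝ (Fin 3)))) → (∀ p : EuclideanSpace ℝ (Fin 3), μ {p} ≠ 0 → HasSum (fun q : {q : EuclideanSpace ℝ (Fin 3) // μ {q} ≠ 0 ∧ q ≠ p} => ((dist p (q : EuclideanSpace ℝ (Fin 3)))⁻¹ ^ 8 - (dist p (q : EuclideanSpace ℝ (Fin 3)))⁻¹ ^ 14) • (p - (q : EuclideanSpace ℝ (Fin 3)))) 0 ∧ (∃ L : ℝ, 0 ≤ L ∧ HasSum (fun q : {q : EuclideanSpace ℝ (Fin 3) // μ {q} ≠ 0 ∧ q ≠ p} => 11 * (dist p (q : EuclideanSpace ℝ (Fin 3)))⁻¹ ^ 14 - 5 * (dist p (q : EuclideanSpace ℝ (Fin 3)))⁻¹ ^ 8) L) ∧ ((∃ q : EuclideanSpace ℝ (Fin 3), μ {q} ≠ 0 ∧ q ≠ p) → ∃ q : EuclideanSpace ℝ (Fin 3), μ {q} ≠ 0 ∧ q ≠ p ∧ dist p q ^ 6 ≤ 11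 / 5)) → {p : EuclideanSpace ℝ (Fin 3) | μ {p} ≠ 0}.Infinite → ¬ (∃ Q : Literature.MathematicalPhysics.StatisticalMechanics.PeriodicConfiguration 3, ∃ t : EuclideanSpace ℝ (Fin 3), {p : EuclideanSpace ℝ (Fin 3) | μ {p} ≠ 0} = (fun s => s + t) '' Q.points) → (⨅ Q : Literature.MathematicalPhysics.StatisticalMechanics.PeriodicConfiguration 3, Q.energyPerParticle Literature.MathematicalPhysics.StatisticalMechanics.lennardJones) ≤ Literature.MathematicalPhysics.StatisticalMechanics.rootEnergy Literature.MathematicalPhysics.StatisticalMechanics.lennardJones μ + (∫⁻ y, F (MeasureTheory.Measure.map (fun z : EuclideanSpace ℝ (Fin 3) => z - y) μ) (-y) ∂μ).toReal - (∫⁻ y, F μ y ∂μ).toReal ∧ (μ ∈ M → (⨅ Q : Literature.MathematicalPhysics.StatisticalMechanics.PeriodicConfiguration 3, Q.energyPerParticle Literature.MathematicalPhysics.StatisticalMechanics.lennardJones) < Literature.MathematicalPhysics.StatisticalMechanics.rootEnergy Literature.MathematicalPhysics.StatisticalMechanics.lennardJones μ + (∫⁻ y, F (MeasureTheory.Measure.map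 (fun z : EuclideanSpace ℝ (Fin 3) => z - y) μ) (-y) ∂μ).toReal - (∫⁻ y, F μ y ∂μ).toReal) ∧ (∃ q : EuclideanSpace ℝ (Fin 3), μ {q} ≠ 0 ∧ ‖q‖ ≤ L ∧ MeasureTheory.Measure.map (fun z : EuclideanSpace ℝ (Fin 3) => z - q) μ ∈ M))) :
    Summit.AtomisticToContinuum.Crystallization.Theses.FrustratedLawDichotomy.AperiodicFrustratedLawGap := by
  intro δ hδ P
  have h' := h δ hδ
  dsimp only at h' ⊢
  intro hP ha hb hd he h0
  obtain ⟨R₇, R₈, R₉, hd'⟩ := hd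
  obtain ⟨F, hF, ⟨C, hC, hbound⟩, M, hM, L, hprice⟩ := h' R₇ R₈ R₉
  by_contra hlt
  have hmin := not_lt.mp hlt
  have h7 : ∀ᵐ μ ∂P, Literature.Probability.Process.IsRootedHardCore (7 / 10) μ := by
    refine ae_isRootedHardCore_upgrade ha (hd'.mono fun μ hμ q hq R ε hε => ?_)
    obtain ⟨N, y, i, ⟨h1, -, -, -, -⟩, hm1, -⟩ := hμ q hq R ε hε
    exact ⟨N, y, i, h1, hm1⟩
  have hEQ : ∀ᵐ μ ∂P, (∀ p : EuclideanSpace ℝ (Fin 3), μ {p} ≠ 0 → HasSum (fun q : {q : EuclideanSpace ℝ (Fin 3) // μ {q} ≠ 0 ∧ q ≠ p} => ((dist p (q : EuclideanSpace ℝ (Fin 3)))⁻¹ ^ 8 - (dist p (q : EuclideanSpace ℝ (Fin 3)))⁻¹ ^ 14) • (p - (q : EuclideanSpace ℝ (Fin 3)))) 0 ∧ (∃ L : ℝ, 0 ≤ L ∧ HasSum (fun q : {q : EuclideanSpace ℝ (Fin 3) // μ {q} ≠ 0 ∧ q ≠ p} => 11 * (dist p (q : EuclideanSpace ℝ (Fin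 3)))⁻¹ ^ 14 - 5 * (dist p (q : EuclideanSpace ℝ (Fin 3)))⁻¹ ^ 8) L) ∧ ((∃ q : EuclideanSpace ℝ (Fin 3), μ {q} ≠ 0 ∧ q ≠ p) → ∃ q : EuclideanSpace ℝ (Fin 3), μ {q} ≠ 0 ∧ q ≠ p ∧ dist p q ^ 6 ≤ 11 / 5)) := by
    filter_upwards [ae_forceBalance_of_nash (by norm_num : (0 : ℝ) < 7 / 10) h7 he,
      ae_laplacian_nonneg_of_nash (by norm_num : (0 : ℝ) < 7 / 10) h7 he,
      ae_exists_near_of_nash (by norm_num : (0 : ℝ) < 7 / 10) h7 he] with μ h₀ h₁ h₂ p hp using ⟨h₀ p hp, h₁ p hp, h₂ p hp⟩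
  have hinf : ∀ᵐ μ ∂P, {p : EuclideanSpace ℝ (Fin 3) | μ {p} ≠ 0}.Infinite :=
    ae_infinite_of_minimising_of_decl Summit.AtomisticToContinuum.Crystallization.Theorems.unimodularEnergyLowerBound_proof
      hδ ha hb hmin
  have hnp : ∀ᵐ μ ∂P, ¬ (∃ Q : Literature.MathematicalPhysics.StatisticalMechanics.PeriodicConfiguration 3, ∃ t : EuclideanSpace ℝ (Fin 3), {p : EuclideanSpace ℝ (Fin 3) | μ {p} ≠ 0} = (fun s => s + t) '' Q.points) := by
    have := measure_eq_zero_iff_ae_notMem.mp h0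
    filter_upwards [this] with μ hμ
    simpa only [Set.mem_setOf_eq] using hμ
  have hout : (∫⁻ μ, ∫⁻ y, F μ y ∂μ ∂P) ≠ ⊤ := by
    refine lintegral_outflow_ne_top_of_bound hC ?_
    filter_upwards [h7, hd'] with μ h7μ hdμ
    exact hbound μ h7μ hdμ
  have hall : ∀ᵐ μ ∂P, (⨅ Q : Literature.MathematicalPhysics.StatisticalMechanics.PeriodicConfiguration 3, Q.energyPerParticle Literature.MathematicalPhysics.StatisticalMechanics.lennardJones) ≤ Literature.MathematicalPhysics.StatisticalMechanics.rootEnergy Literature.MathematicalPhysics.StatisticalMechanics.lennardJones μ + (∫⁻ y, F (MeasureTheory.Measure.map (fun z : EuclideanSpace ℝ (Fin 3) => z - y) μ) (-y) ∂μ).toReal - (∫⁻ y, F μ y ∂μ).toReal ∧ (μ ∈ M → (⨅ Q : Literature.MathematicalPhysics.StatisticalMechanics.PeriodicConfiguration 3, Q.energyPerParticle Literature.MathematicalPhysics.StatisticalMechanics.lennardJones) < Literature.MathematicalPhysics.StatisticalMechanics.rootEnergy Literature.MathematicalPhysics.StatisticalMechanics.lennardJones μ + (∫⁻ y, F (MeasureTheory.Measure.map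 (fun z : EuclideanSpace ℝ (Fin 3) => z - y) μ) (-y) ∂μ).toReal - (∫⁻ y, F μ y ∂μ).toReal) ∧ (∃ q : EuclideanSpace ℝ (Fin 3), μ {q} ≠ 0 ∧ ‖q‖ ≤ L ∧ MeasureTheory.Measure.map (fun z : EuclideanSpace ℝ (Fin 3) => z - q) μ ∈ M) := by
    filter_upwards [ha, h7, hd', he, hEQ, hinf, hnp] with μ haμ h7μ hdμ heμ hEμ hiμ hnμ
    exact hprice μ haμ h7μ hdμ heμ hEμ hiμ hnμ
  exact hlt (lt_integral_rootEnergy_of_markedTransport (by norm_num : (0 : ℝ) < 7 / 10) h7 hb hF hout hM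
    (hall.mono fun μ hμ => hμ.2.2) (hall.mono fun μ hμ => hμ.1) (hall.mono fun μ hμ => hμ.2.1))

/-- **MARKED-PRICE DOOR for the registered stub** (`S_aperiodicErgodicGap` verbatim). [folklore] -/
theorem aperiodicErgodicGap_of_markedTransportPrice
    (h : ∀ δ : ℝ, 0 < δ → ∀ R₇ R₈ R₉ : ℝ, let Gy : ℝ → (N : ℕ) → (Fin N → EuclideanSpace ℝ (Fin 3)) → Fin N → Prop := fun η N y j => let d : ℝ := sInf ((fun z => dist z (y (j : Fin N))) '' (Set.range (y) \ {(y (j : Fin N))})); let T : Set (EuclideanSpace ℝ (Fin 3)) := {z : EuclideanSpace ℝ (Fin 3) | z ∈ Set.range (y) ∧ z ≠ (y (j : Fin N)) ∧ dist z (y (j : Fin N)) < 13 / 10 * d}; ∃ A : EuclideanSpace ℝ (Fin 3) →ₗᵢ[ℝ] EuclideanSpace ℝ (Fin 3), (∃ e : ↥T ≃ ↥Literature.Geometry.DiscreteGeometry.fccKissingPattern, ∀ t : ↥T, dist (d⁻¹ • ((t : EuclideanSpace ℝ (Fin 3)) - (y (j : Fin N)))) (A ((e t : ↥Literature.Geometry.DiscreteGeometry.fccKissingPattern)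 : EuclideanSpace ℝ (Fin 3))) ≤ η) ∨ (∃ e : ↥T ≃ ↥Literature.Geometry.DiscreteGeometry.hcpKissingPattern, ∀ t : ↥T, dist (d⁻¹ • ((t : EuclideanSpace ℝ (Fin 3)) - (y (j : Fin N)))) (A ((e t : ↥Literature.Geometry.DiscreteGeometry.hcpKissingPattern) : EuclideanSpace ℝ (Fin 3))) ≤ η); let TexBall : (N : ℕ) → (Fin N → EuclideanSpace ℝ (Fin 3)) → Fin N → ℝ → ℝ → ℝ → ℝ → Prop := fun N y i R R₇ R₈ R₉ => (∀ a b : Fin N, a ≠ b → (7 : ℝ) / 10 ≤ dist (y a) (y b)) ∧ (∀ j : Fin N, dist (y j) (y i) ≤ R → ¬ Gy (1 / 20) N (y) j) ∧ (∀ j : Fin N, dist (y j) (y i) ≤ R → ¬ ((∀ j' : Fin N, dist (y j') (y j) ≤ R₇ → ¬ Gy (1 / 20) N (y) j') ∧ (∀ z : EuclideanSpace ℝ (Fin 3), dist z (y j) ≤ R₇ → ∃ k : Fin N, dist z (y k) ≤ 1) ∧ (∀ j' : Fin N, dist (y j') (y j) ≤ R₇ → (let d : ℝ := sInf ((fun z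 => dist z (y j')) '' (Set.range (y) \ {(y j')})); ∀ k : Fin N, y k ≠ y j' → dist (y k) (y j') < 27 / 20 * d → 5 ≤ Nat.card {m : Fin N // y m ≠ y j' ∧ dist (y m) (y j') < 27 / 20 * d ∧ y m ≠ y k ∧ dist (y m) (y k) < 27 / 20 * d})))) ∧ (∀ j : Fin N, dist (y j) (y i) ≤ R → ∃ k : Fin N, dist (y k) (y j) ≤ R₈ ∧ Gy (1 / 8) N (y) k) ∧ (∀ j : Fin N, dist (y j) (y i) ≤ R → ¬ ((∀ j' : Fin N, dist (y j') (y j) ≤ R₉ → ¬ Gy (1 / 20) N (y) j') ∧ (Nat.card {j' : Fin N // dist (y j') (y j) ≤ R₉ ∧ ¬ Gy (1 / 8) N (y) j'} : ℝ) ≤ 1 / 2 * (Nat.card {j' : Fin N // dist (y j') (y j) ≤ R₉} : ℝ) ∧ (∀ j' : Fin N, dist (y j') (y j) ≤ R₉ → ¬ Gy (1 / 8) N (y) j' → ¬ (let d : ℝ := sInf ((fun z => dist z (y j')) '' (Set.range (y) \ {(y j')})); ∀ k : Fin N, y k ≠ y j' → dist (y k) (y j') < 27 / 20 * d → 5 ≤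 Nat.card {m : Fin N // y m ≠ y j' ∧ dist (y m) (y j') < 27 / 20 * d ∧ y m ≠ y k ∧ dist (y m) (y k) < 27 / 20 * d})))); let Appr : MeasureTheory.Measure (EuclideanSpace ℝ (Fin 3)) → ℝ → ℝ → ℝ → Prop := fun μ R₇ R₈ R₉ => ∀ q : EuclideanSpace ℝ (Fin 3), μ {q} ≠ 0 → ∀ R ε : ℝ, 0 < ε → ∃ (N : ℕ) (y : Fin N → EuclideanSpace ℝ (Fin 3)) (i : Fin N), TexBall N y i R R₇ R₈ R₉ ∧ (∀ p : EuclideanSpace ℝ (Fin 3), μ {p} ≠ 0 → dist p q ≤ R → ∃ k : Fin N, dist (y k - y i) (p - q) ≤ ε) ∧ (∀ k : Fin N, dist (y k) (y i) ≤ R → ∃ p : EuclideanSpace ℝ (Fin 3), μ {p} ≠ 0 ∧ dist (y k - y i) (p - q) ≤ ε); ∃ F : MeasureTheory.Measure (EuclideanSpace ℝ (Fin 3)) → EuclideanSpace ℝ (Fin 3) → ENNReal, Measurable (Function.uncurry F) ∧ (∃ C : ENNReal, C ≠ ⊤ ∧ ∀ μ : MeasureTheory.Measure (EuclideanSpace ℝ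 (Fin 3)), Literature.Probability.Process.IsRootedHardCore (7 / 10) μ → Appr μ R₇ R₈ R₉ → (∫⁻ y, F μ y ∂μ) ≤ C) ∧ ∃ M : Set (MeasureTheory.Measure (EuclideanSpace ℝ (Fin 3))), MeasurableSet M ∧ ∃ L : ℝ, (∀ μ : MeasureTheory.Measure (EuclideanSpace ℝ (Fin 3)), Literature.Probability.Process.IsRootedHardCore δ μ → Literature.Probability.Process.IsRootedHardCore (7 / 10) μ → Appr μ R₇ R₈ R₉ → (∀ p : EuclideanSpace ℝ (Fin 3), μ {p} ≠ 0 → ∀ y : EuclideanSpace ℝ (Fin 3), (∀ q : EuclideanSpace ℝ (Fin 3), μ {q} ≠ 0 → q ≠ p → y ≠ q) → ∑' q : {q : EuclideanSpace ℝ (Fin 3) // μ {q} ≠ 0 ∧ q ≠ p}, Literature.MathematicalPhysics.StatisticalMechanics.lennardJones (dist p (q : EuclideanSpace ℝ (Fin 3))) ≤ ∑' q : {q : EuclideanSpace ℝ (Fin 3) // μ {q} ≠ 0 ∧ q ≠ p}, Literature.MathematicalPhysics.StatisticalMechanics.lennardJones (dist y (q : EuclideanSpace ℝ (Fin 3))))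 → (∀ p : EuclideanSpace ℝ (Fin 3), μ {p} ≠ 0 → HasSum (fun q : {q : EuclideanSpace ℝ (Fin 3) // μ {q} ≠ 0 ∧ q ≠ p} => ((dist p (q : EuclideanSpace ℝ (Fin 3)))⁻¹ ^ 8 - (dist p (q : EuclideanSpace ℝ (Fin 3)))⁻¹ ^ 14) • (p - (q : EuclideanSpace ℝ (Fin 3)))) 0 ∧ (∃ L : ℝ, 0 ≤ L ∧ HasSum (fun q : {q : EuclideanSpace ℝ (Fin 3) // μ {q} ≠ 0 ∧ q ≠ p} => 11 * (dist p (q : EuclideanSpace ℝ (Fin 3)))⁻¹ ^ 14 - 5 * (dist p (q : EuclideanSpace ℝ (Fin 3)))⁻¹ ^ 8) L) ∧ ((∃ q : EuclideanSpace ℝ (Fin 3), μ {q} ≠ 0 ∧ q ≠ p) → ∃ q : EuclideanSpace ℝ (Fin 3), μ {q} ≠ 0 ∧ q ≠ p ∧ dist p q ^ 6 ≤ 11 / 5)) → {p : EuclideanSpace ℝ (Fin 3) | μ {p} ≠ 0}.Infinite → ¬ (∃ Q : Literature.MathematicalPhysics.StatisticalMechanics.PeriodicConfiguration 3, ∃ t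 : EuclideanSpace ℝ (Fin 3), {p : EuclideanSpace ℝ (Fin 3) | μ {p} ≠ 0} = (fun s => s + t) '' Q.points) → (⨅ Q : Literature.MathematicalPhysics.StatisticalMechanics.PeriodicConfiguration 3, Q.energyPerParticle Literature.MathematicalPhysics.StatisticalMechanics.lennardJones) ≤ Literature.MathematicalPhysics.StatisticalMechanics.rootEnergy Literature.MathematicalPhysics.StatisticalMechanics.lennardJones μ + (∫⁻ y, F (MeasureTheory.Measure.map (fun z : EuclideanSpace ℝ (Fin 3) => z - y) μ) (-y) ∂μ).toReal - (∫⁻ y, F μ y ∂μ).toReal ∧ (μ ∈ M → (⨅ Q : Literature.MathematicalPhysics.StatisticalMechanics.PeriodicConfiguration 3, Q.energyPerParticle Literature.MathematicalPhysics.StatisticalMechanics.lennardJones) < Literature.MathematicalPhysics.StatisticalMechanics.rootEnergy Literature.MathematicalPhysics.StatisticalMechanics.lennardJones μ + (∫⁻ y, F (MeasureTheory.Measure.map (fun z : EuclideanSpace ℝ (Fin 3) => z - y) μ) (-y) ∂μ).toReal - (∫⁻ y, F μ y ∂μ).toReal) ∧ (∃ q : EuclideanSpace ℝ (Fin 3),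 μ {q} ≠ 0 ∧ ‖q‖ ≤ L ∧ MeasureTheory.Measure.map (fun z : EuclideanSpace ℝ (Fin 3) => z - q) μ ∈ M))) :
    ∀ δ : ℝ, 0 < δ → ∀ P : MeasureTheory.Measure (MeasureTheory.Measure (EuclideanSpace ℝ (Fin 3))), let Gy : ℝ → (N : ℕ) → (Fin N → EuclideanSpace ℝ (Fin 3)) → Fin N → Prop := fun η N y j => let d : ℝ := sInf ((fun z => dist z (y (j : Fin N))) '' (Set.range (y) \ {(y (j : Fin N))})); let T : Set (EuclideanSpace ℝ (Fin 3)) := {z : EuclideanSpace ℝ (Fin 3) | z ∈ Set.range (y) ∧ z ≠ (y (j : Fin N)) ∧ dist z (y (j : Fin N)) < 13 / 10 * d}; ∃ A : EuclideanSpace ℝ (Fin 3) →ₗᵢ[ℝ] EuclideanSpace ℝ (Fin 3), (∃ e : ↥T ≃ ↥Literature.Geometry.DiscreteGeometry.fccKissingPattern, ∀ t : ↥T, dist (d⁻¹ • ((t : EuclideanSpace ℝ (Fin 3)) - (y (j : Fin N)))) (A ((e t : ↥Literature.Geometry.DiscreteGeometry.fccKissingPattern) : EuclideanSpace ℝ (Fin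 3))) ≤ η) ∨ (∃ e : ↥T ≃ ↥Literature.Geometry.DiscreteGeometry.hcpKissingPattern, ∀ t : ↥T, dist (d⁻¹ • ((t : EuclideanSpace ℝ (Fin 3)) - (y (j : Fin N)))) (A ((e t : ↥Literature.Geometry.DiscreteGeometry.hcpKissingPattern) : EuclideanSpace ℝ (Fin 3))) ≤ η); let TexBall : (N : ℕ) → (Fin N → EuclideanSpace ℝ (Fin 3)) → Fin N → ℝ → ℝ → ℝ → ℝ → Prop := fun N y i R R₇ R₈ R₉ => (∀ a b : Fin N, a ≠ b → (7 : ℝ) / 10 ≤ dist (y a) (y b)) ∧ (∀ j : Fin N, dist (y j) (y i) ≤ R → ¬ Gy (1 / 20) N (y) j) ∧ (∀ j : Fin N, dist (y j) (y i) ≤ R → ¬ ((∀ j' : Fin N, dist (y j') (y j) ≤ R₇ → ¬ Gy (1 / 20) N (y) j') ∧ (∀ z : EuclideanSpace ℝ (Fin 3), dist z (y j) ≤ R₇ → ∃ k : Fin N, dist z (y k) ≤ 1) ∧ (∀ j' : Fin N, dist (y j') (y j) ≤ R₇ → (let d : ℝ := sInf ((fun z => dist z (y j')) '' (Set.range (y)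 \ {(y j')})); ∀ k : Fin N, y k ≠ y j' → dist (y k) (y j') < 27 / 20 * d → 5 ≤ Nat.card {m : Fin N // y m ≠ y j' ∧ dist (y m) (y j') < 27 / 20 * d ∧ y m ≠ y k ∧ dist (y m) (y k) < 27 / 20 * d})))) ∧ (∀ j : Fin N, dist (y j) (y i) ≤ R → ∃ k : Fin N, dist (y k) (y j) ≤ R₈ ∧ Gy (1 / 8) N (y) k) ∧ (∀ j : Fin N, dist (y j) (y i) ≤ R → ¬ ((∀ j' : Fin N, dist (y j') (y j) ≤ R₉ → ¬ Gy (1 / 20) N (y) j') ∧ (Nat.card {j' : Fin N // dist (y j') (y j) ≤ R₉ ∧ ¬ Gy (1 / 8) N (y) j'} : ℝ) ≤ 1 / 2 * (Nat.card {j' : Fin N // dist (y j') (y j) ≤ R₉} : ℝ) ∧ (∀ j' : Fin N, dist (y j') (y j) ≤ R₉ → ¬ Gy (1 / 8) N (y) j' → ¬ (let d : ℝ := sInf ((fun z => dist z (y j')) '' (Set.range (y) \ {(y j')})); ∀ k : Fin N, y k ≠ y j' → dist (y k) (y j') < 27 / 20 * d → 5 ≤ Nat.card {m : Fin N // y m ≠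 y j' ∧ dist (y m) (y j') < 27 / 20 * d ∧ y m ≠ y k ∧ dist (y m) (y k) < 27 / 20 * d})))); let Appr : MeasureTheory.Measure (EuclideanSpace ℝ (Fin 3)) → ℝ → ℝ → ℝ → Prop := fun μ R₇ R₈ R₉ => ∀ q : EuclideanSpace ℝ (Fin 3), μ {q} ≠ 0 → ∀ R ε : ℝ, 0 < ε → ∃ (N : ℕ) (y : Fin N → EuclideanSpace ℝ (Fin 3)) (i : Fin N), TexBall N y i R R₇ R₈ R₉ ∧ (∀ p : EuclideanSpace ℝ (Fin 3), μ {p} ≠ 0 → dist p q ≤ R → ∃ k : Fin N, dist (y k - y i) (p - q) ≤ ε) ∧ (∀ k : Fin N, dist (y k) (y i) ≤ R → ∃ p : EuclideanSpace ℝ (Fin 3), μ {p} ≠ 0 ∧ dist (y k - y i) (p - q) ≤ ε); MeasureTheory.IsProbabilityMeasure P → (∀ᵐ μ ∂P, Literature.Probability.Process.IsRootedHardCore δ μ) → Literature.Probability.Process.IsPointStationaryLaw P → (∃ R₇ R₈ R₉ : ℝ, ∀ᵐ μ ∂P, Appr μ R₇ R₈ R₉) → (∀ᵐ μ ∂P,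 ∀ p : EuclideanSpace ℝ (Fin 3), μ {p} ≠ 0 → ∀ y : EuclideanSpace ℝ (Fin 3), (∀ q : EuclideanSpace ℝ (Fin 3), μ {q} ≠ 0 → q ≠ p → y ≠ q) → ∑' q : {q : EuclideanSpace ℝ (Fin 3) // μ {q} ≠ 0 ∧ q ≠ p}, Literature.MathematicalPhysics.StatisticalMechanics.lennardJones (dist p (q : EuclideanSpace ℝ (Fin 3))) ≤ ∑' q : {q : EuclideanSpace ℝ (Fin 3) // μ {q} ≠ 0 ∧ q ≠ p}, Literature.MathematicalPhysics.StatisticalMechanics.lennardJones (dist y (q : EuclideanSpace ℝ (Fin 3)))) → P {μ : MeasureTheory.Measure (EuclideanSpace ℝ (Fin 3)) | ∃ Q : Literature.MathematicalPhysics.StatisticalMechanics.PeriodicConfiguration 3, ∃ t : EuclideanSpace ℝ (Fin 3), {p : EuclideanSpace ℝ (Fin 3) | μ {p} ≠ 0} = (fun s => s + t) '' Q.points} = 0 → (∀ A : Set (MeasureTheory.Measure (EuclideanSpace ℝ (Fin 3))), MeasurableSet A → (∀ μ : MeasureTheory.Measure (EuclideanSpace ℝ (Fin 3)), ∀ p :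 EuclideanSpace ℝ (Fin 3), μ {p} ≠ 0 → (μ ∈ A ↔ MeasureTheory.Measure.map (fun z : EuclideanSpace ℝ (Fin 3) => z - p) μ ∈ A)) → P A = 0 ∨ P Aᶜ = 0) → (⨅ Q : Literature.MathematicalPhysics.StatisticalMechanics.PeriodicConfiguration 3, Q.energyPerParticle Literature.MathematicalPhysics.StatisticalMechanics.lennardJones) < (∫ μ, Literature.MathematicalPhysics.StatisticalMechanics.rootEnergy Literature.MathematicalPhysics.StatisticalMechanics.lennardJones μ ∂P) := by
  have hc := aperiodicFrustratedLawGap_of_markedTransportPrice h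
  intro δ hδ P
  have h' := hc δ hδ P
  dsimp only at h' ⊢
  intro hP ha hb hd he h0 _
  exact h' hP ha hb hd he h0

/-- **MARKED-PRICE DOOR for the `PeriodicChargeSplit` copy.** [folklore] -/
theorem periodicChargeSplit_aperiodicFrustratedLawGap_of_markedTransportPrice
    (h : ∀ δ : ℝ, 0 < δ → ∀ R₇ R₈ R₉ : ℝ, let Gy : ℝ → (N : ℕ) → (Fin N → EuclideanSpace ℝ (Fin 3)) → Fin N → Prop := fun η N y j => let d : ℝ := sInf ((fun z => dist z (y (j : Fin N))) '' (Set.range (y) \ {(y (j : Fin N))})); let T : Set (EuclideanSpace ℝ (Fin 3)) := {z : EuclideanSpace ℝ (Fin 3) | z ∈ Set.range (y) ∧ z ≠ (y (j : Fin N)) ∧ dist z (y (j : Fin N)) < 13 / 10 * d}; ∃ A : EuclideanSpace ℝ (Fin 3) →ₗᵢ[ℝ] EuclideanSpace ℝ (Fin 3), (∃ e : ↥T ≃ ↥Literature.Geometry.DiscreteGeometry.fccKissingPattern, ∀ t : ↥T, dist (d⁻¹ • ((t : EuclideanSpace ℝ (Fin 3)) - (y (j : Fin N)))) (A ((e t :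 ↥Literature.Geometry.DiscreteGeometry.fccKissingPattern) : EuclideanSpace ℝ (Fin 3))) ≤ η) ∨ (∃ e : ↥T ≃ ↥Literature.Geometry.DiscreteGeometry.hcpKissingPattern, ∀ t : ↥T, dist (d⁻¹ • ((t : EuclideanSpace ℝ (Fin 3)) - (y (j : Fin N)))) (A ((e t : ↥Literature.Geometry.DiscreteGeometry.hcpKissingPattern) : EuclideanSpace ℝ (Fin 3))) ≤ η); let TexBall : (N : ℕ) → (Fin N → EuclideanSpace ℝ (Fin 3)) → Fin N → ℝ → ℝ → ℝ → ℝ → Prop := fun N y i R R₇ R₈ R₉ => (∀ a b : Fin N, a ≠ b → (7 : ℝ) / 10 ≤ dist (y a) (y b)) ∧ (∀ j : Fin N, dist (y j) (y i) ≤ R → ¬ Gy (1 / 20) N (y) j) ∧ (∀ j : Fin N, dist (y j) (y i) ≤ R → ¬ ((∀ j' : Fin N, dist (y j') (y j) ≤ R₇ → ¬ Gy (1 / 20) N (y) j') ∧ (∀ z : EuclideanSpace ℝ (Fin 3), dist z (y j) ≤ R₇ → ∃ k : Fin N, dist z (y k) ≤ 1) ∧ (∀ j' : Fin N, dist (y j')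 (y j) ≤ R₇ → (let d : ℝ := sInf ((fun z => dist z (y j')) '' (Set.range (y) \ {(y j')})); ∀ k : Fin N, y k ≠ y j' → dist (y k) (y j') < 27 / 20 * d → 5 ≤ Nat.card {m : Fin N // y m ≠ y j' ∧ dist (y m) (y j') < 27 / 20 * d ∧ y m ≠ y k ∧ dist (y m) (y k) < 27 / 20 * d})))) ∧ (∀ j : Fin N, dist (y j) (y i) ≤ R → ∃ k : Fin N, dist (y k) (y j) ≤ R₈ ∧ Gy (1 / 8) N (y) k) ∧ (∀ j : Fin N, dist (y j) (y i) ≤ R → ¬ ((∀ j' : Fin N, dist (y j') (y j) ≤ R₉ → ¬ Gy (1 / 20) N (y) j') ∧ (Nat.card {j' : Fin N // dist (y j') (y j) ≤ R₉ ∧ ¬ Gy (1 / 8) N (y) j'} : ℝ) ≤ 1 / 2 * (Nat.card {j' : Fin N // dist (y j') (y j) ≤ R₉} : ℝ) ∧ (∀ j' : Fin N, dist (y j') (y j) ≤ R₉ → ¬ Gy (1 / 8) N (y) j' → ¬ (let d : ℝ := sInf ((fun z => dist z (y j')) '' (Set.range (y) \ {(y j')})); ∀ k : Fin N, y k ≠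 y j' → dist (y k) (y j') < 27 / 20 * d → 5 ≤ Nat.card {m : Fin N // y m ≠ y j' ∧ dist (y m) (y j') < 27 / 20 * d ∧ y m ≠ y k ∧ dist (y m) (y k) < 27 / 20 * d})))); let Appr : MeasureTheory.Measure (EuclideanSpace ℝ (Fin 3)) → ℝ → ℝ → ℝ → Prop := fun μ R₇ R₈ R₉ => ∀ q : EuclideanSpace ℝ (Fin 3), μ {q} ≠ 0 → ∀ R ε : ℝ, 0 < ε → ∃ (N : ℕ) (y : Fin N → EuclideanSpace ℝ (Fin 3)) (i : Fin N), TexBall N y i R R₇ R₈ R₉ ∧ (∀ p : EuclideanSpace ℝ (Fin 3), μ {p} ≠ 0 → dist p q ≤ R → ∃ k : Fin N, dist (y k - y i) (p - q) ≤ ε) ∧ (∀ k : Fin N, dist (y k) (y i) ≤ R → ∃ p : EuclideanSpace ℝ (Fin 3), μ {p} ≠ 0 ∧ dist (y k - y i) (p - q) ≤ ε); ∃ F : MeasureTheory.Measure (EuclideanSpace ℝ (Fin 3)) → EuclideanSpace ℝ (Fin 3) → ENNReal, Measurable (Function.uncurry F) ∧ (∃ C : ENNReal, C ≠ ⊤ ∧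 ∀ μ : MeasureTheory.Measure (EuclideanSpace ℝ (Fin 3)), Literature.Probability.Process.IsRootedHardCore (7 / 10) μ → Appr μ R₇ R₈ R₉ → (∫⁻ y, F μ y ∂μ) ≤ C) ∧ ∃ M : Set (MeasureTheory.Measure (EuclideanSpace ℝ (Fin 3))), MeasurableSet M ∧ ∃ L : ℝ, (∀ μ : MeasureTheory.Measure (EuclideanSpace ℝ (Fin 3)), Literature.Probability.Process.IsRootedHardCore δ μ → Literature.Probability.Process.IsRootedHardCore (7 / 10) μ → Appr μ R₇ R₈ R₉ → (∀ p : EuclideanSpace ℝ (Fin 3), μ {p} ≠ 0 → ∀ y : EuclideanSpace ℝ (Fin 3), (∀ q : EuclideanSpace ℝ (Fin 3), μ {q} ≠ 0 → q ≠ p → y ≠ q) → ∑' q : {q : EuclideanSpace ℝ (Fin 3) // μ {q} ≠ 0 ∧ q ≠ p}, Literature.MathematicalPhysics.StatisticalMechanics.lennardJones (dist p (q : EuclideanSpace ℝ (Fin 3))) ≤ ∑' q : {q : EuclideanSpace ℝ (Fin 3) // μ {q} ≠ 0 ∧ q ≠ p}, Literature.MathematicalPhysics.StatisticalMechanics.lennardJones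 (dist y (q : EuclideanSpace ℝ (Fin 3)))) → (∀ p : EuclideanSpace ℝ (Fin 3), μ {p} ≠ 0 → HasSum (fun q : {q : EuclideanSpace ℝ (Fin 3) // μ {q} ≠ 0 ∧ q ≠ p} => ((dist p (q : EuclideanSpace ℝ (Fin 3)))⁻¹ ^ 8 - (dist p (q : EuclideanSpace ℝ (Fin 3)))⁻¹ ^ 14) • (p - (q : EuclideanSpace ℝ (Fin 3)))) 0 ∧ (∃ L : ℝ, 0 ≤ L ∧ HasSum (fun q : {q : EuclideanSpace ℝ (Fin 3) // μ {q} ≠ 0 ∧ q ≠ p} => 11 * (dist p (q : EuclideanSpace ℝ (Fin 3)))⁻¹ ^ 14 - 5 * (dist p (q : EuclideanSpace ℝ (Fin 3)))⁻¹ ^ 8) L) ∧ ((∃ q : EuclideanSpace ℝ (Fin 3), μ {q} ≠ 0 ∧ q ≠ p) → ∃ q : EuclideanSpace ℝ (Fin 3), μ {q} ≠ 0 ∧ q ≠ p ∧ dist p q ^ 6 ≤ 11 / 5)) → {p : EuclideanSpace ℝ (Fin 3) | μ {p} ≠ 0}.Infinite → ¬ (∃ Q : Literature.MathematicalPhysics.StatisticalMechanics.PeriodicConfiguration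 3, ∃ t : EuclideanSpace ℝ (Fin 3), {p : EuclideanSpace ℝ (Fin 3) | μ {p} ≠ 0} = (fun s => s + t) '' Q.points) → (⨅ Q : Literature.MathematicalPhysics.StatisticalMechanics.PeriodicConfiguration 3, Q.energyPerParticle Literature.MathematicalPhysics.StatisticalMechanics.lennardJones) ≤ Literature.MathematicalPhysics.StatisticalMechanics.rootEnergy Literature.MathematicalPhysics.StatisticalMechanics.lennardJones μ + (∫⁻ y, F (MeasureTheory.Measure.map (fun z : EuclideanSpace ℝ (Fin 3) => z - y) μ) (-y) ∂μ).toReal - (∫⁻ y, F μ y ∂μ).toReal ∧ (μ ∈ M → (⨅ Q : Literature.MathematicalPhysics.StatisticalMechanics.PeriodicConfiguration 3, Q.energyPerParticle Literature.MathematicalPhysics.StatisticalMechanics.lennardJones) < Literature.MathematicalPhysics.StatisticalMechanics.rootEnergy Literature.MathematicalPhysics.StatisticalMechanics.lennardJones μ + (∫⁻ y, F (MeasureTheory.Measure.map (fun z : EuclideanSpace ℝ (Fin 3) => z - y) μ) (-y) ∂μ).toReal - (∫⁻ y, F μ y ∂μ).toReal) ∧ (∃ q : EuclideanSpace ℝ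 (Fin 3), μ {q} ≠ 0 ∧ ‖q‖ ≤ L ∧ MeasureTheory.Measure.map (fun z : EuclideanSpace ℝ (Fin 3) => z - q) μ ∈ M))) :
    Summit.AtomisticToContinuum.Crystallization.Theses.PeriodicChargeSplit.AperiodicFrustratedLawGap :=
  periodicChargeSplit_aperiodicFrustratedLawGap_iff_ergodicCase.mpr (aperiodicErgodicGap_of_markedTransportPrice h)

end Summit.AtomisticToContinuum.Crystallization.Theorems.FrustratedLawDichotomyTransportPriceMarked

end
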